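import Literature.Analysis.Complex.SchwarzReflection
import Mathlib.Analysis.Calculus.Deriv.Star
import HarnessLib

/-!
# Global Schwarz reflection of a half-plane map with `0 < im f ≤ im`

Topic: complex analysis. Everything here is proved.

`Literature/Analysis/Complex/SchwarzReflection.lean` proves the Schwarz reflection principle
(`Complex.differentiableOn_schwarzReflection`, for functions already continuous up to the real
axis with real boundary values) and the LOCAL package
`Complex.exists_differentiableOn_extension_of_im_le`: a holomorphic `f` on a half-disc
`B(x, r) ∩ ℍ` with `0 < im f ≤ im` extends holomorphically to `B(x, r/2)` (the bound
`im f ≤ im` forces `im f → 0` at the diameter, and Schwarz–Pick makes `f` Lipschitz there). This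
file GLUES the local extensions: for an open, conjugation-symmetric `U ⊆ ℂ` and `f` holomorphic
on `U ∩ ℍ` with `0 < im f(z) ≤ im z` there,

* `upperExt U f` — `f` on `{im > 0}`, and at other points the limit of `f` from `U ∩ ℍ`
  (`limUnder`), i.e. the boundary values on `U ∩ ℝ`;
* `schwarzExt U f = Complex.schwarzReflection (upperExt U f)` — the global reflection;

and proves: `schwarzExt U f` is holomorphic on `U` (`differentiableOn_schwarzExt`), equals `f`
on `U ∩ ℍ`, commutes with conjugation on `U`, is real on `U ∩ ℝ` with `im < 0` below,
`f → schwarzExt U f x` at real points `x ∈ U` from `U ∩ ℍ` (`tendsto_schwarzExt_ofReal`), and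
the **uniform derivative bound** `‖(schwarzExt U f)'(z)‖ ≤ 2` on `B(x, r/2)` whenever
`B(x, r) ⊆ U`, `x ∈ ℝ` (`norm_deriv_schwarzExt_le_two`, Schwarz–Pick). This is the situation
of the map `g_A` of a half-plane hull (G. F. Lawler, *Conformally Invariant Processes in the
Plane* (2005), §3.4, proof of Prop. 3.36, which extends a Riemann map `g : ℍ ∖ A → ℍ` by the
Schwarz reflection principle (Rudin 11.14) to a conformal transformation of `{|z| > r}` with
`g(z̄) = conj g(z)` when `A ⊆ B(0, r)`; here the reflection is across all of `ℝ ∖ A`) and of the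
Loewner maps `g_t` off the hull (ibid. §4.1 p. 96), used for the conformal-image Loewner chains
of Lawler §4.6 / Lawler–Schramm–Werner (2003) §5.

The tree already has a LOCAL homonym `Literature.Probability.RandomPlanarGeometry.reflectExt`
(`KernelConvergence.lean`: the reflection of a restriction map on a disc `B(0, r)`, from
`IsRestrictionMap.exists_extension`); the present `schwarzExt` is the global construction for
general `U`, of which that one is the special case `U = B(0, r)` (refactor note for the
librarian, cf. the note in `SchwarzReflection.lean`).

## References

* J. B. Conway, *Functions of One Complex Variable I* (1978), Ch. IX Thm. 1.1 [Conway1978].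
* G. F. Lawler, *Conformally Invariant Processes in the Plane*, AMS (2005), §3.4 (proof of
  Prop. 3.36), §4.1 p. 96 [Lawler2005].
* W. Rudin, *Real and Complex Analysis* (1987), Thm. 11.14.
-/

noncomputable section

open Set Filter Metric
open _root_.Complex _root_.Topology
open scoped ComplexConjugate

namespace Literature.Analysis.Complex

/-! ### The glued extension and its reflection -/

/-- **Boundary-value extension to the closed upper half-plane**: `f` on `{im > 0}`, and
elsewhere the limit of `f` from `U ∩ ℍ` (meaningful at real points of `U`). [folklore] -/
def upperExt (U : Set ℂ) (f : ℂ → ℂ) (z : ℂ) : ℂ :=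
  if 0 < z.im then f z else limUnder (𝓝[U ∩ {w | 0 < w.im}] z) f

/-- **Global Schwarz reflection** of `f` across `U ∩ ℝ`. [cite: Conway1978, Ch. IX Thm. 1.1] -/
def schwarzExt (U : Set ℂ) (f : ℂ → ℂ) : ℂ → ℂ :=
  schwarzReflection (upperExt U f)

variable {U : Set ℂ} {f : ℂ → ℂ}

/-- On `{im > 0}`, `upperExt U f = f`. [folklore] -/
theorem upperExt_of_im_pos {z : ℂ} (hz : 0 < z.im) : upperExt U f z = f z := if_pos hz

/-- On `{im > 0}`, `schwarzExt U f = f`. [folklore] -/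
theorem schwarzExt_of_im_pos {z : ℂ} (hz : 0 < z.im) : schwarzExt U f z = f z := by
  rw [schwarzExt, schwarzReflection_of_nonneg hz.le, upperExt_of_im_pos hz]

/-- On `{im < 0}`, `schwarzExt U f z = conj (f (conj z))`. [folklore] -/
theorem schwarzExt_of_im_neg {z : ℂ} (hz : z.im < 0) : schwarzExt U f z = conj (f (conj z)) := by
  rw [schwarzExt, schwarzReflection_of_neg hz, upperExt_of_im_pos]
  rw [conj_im]; linarith

/-- At a real point, `schwarzExt U f x = upperExt U f x` (the boundary value). [folklore] -/
theorem schwarzExt_ofReal (x : ℝ) : schwarzExt U f x = upperExt U f x := by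
  rw [schwarzExt, schwarzReflection_ofReal]

/-- `schwarzExt` agrees with `f` near every point of the open upper half-plane. [folklore] -/
theorem schwarzExt_eventuallyEq_of_im_pos {z : ℂ} (hz : 0 < z.im) : schwarzExt U f =ᶠ[𝓝 z] f := by
  filter_upwards [(isOpen_lt continuous_const continuous_im).mem_nhds hz] with w hw
  exact schwarzExt_of_im_pos hw

/-- `schwarzExt` agrees with `conj ∘ f ∘ conj` near every point of the lower half-plane. [folklore] -/
theorem schwarzExt_eventuallyEq_of_im_neg {z : ℂ} (hz : z.im < 0) :
    schwarzExt U f =ᶠ[𝓝 z] (conj ∘ f ∘ conj) := by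
  filter_upwards [(isOpen_lt continuous_im continuous_const).mem_nhds hz] with w hw
  exact schwarzExt_of_im_neg hw

/-! ### The hypotheses: `U` open symmetric, `f` holomorphic on `U ∩ ℍ` with `0 < im f ≤ im` -/

section Main

variable (hU : IsOpen U) (hUsymm : ∀ z ∈ U, conj z ∈ U)
  (hd : DifferentiableOn ℂ f (U ∩ {w | 0 < w.im}))
  (him : ∀ z ∈ U ∩ {w : ℂ | 0 < w.im}, 0 < (f z).im ∧ (f z).im ≤ z.im)

/-- A real point of the open set `U` has a disc `B(x, r) ⊆ U`. [folklore] -/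
theorem exists_ball_subset_of_ofReal_mem (hU : IsOpen U) {x : ℝ} (hx : (x : ℂ) ∈ U) :
    ∃ r > 0, ball (x : ℂ) r ⊆ U :=
  Metric.isOpen_iff.1 hU _ hx

/-- Points `x + iy`, `y ↓ 0`, approach the real point `x` inside `U ∩ ℍ`; so `𝓝[U ∩ ℍ] x` is
nontrivial for real `x ∈ U`. [folklore] -/
theorem neBot_nhdsWithin_ofReal (hU : IsOpen U) {x : ℝ} (hx : (x : ℂ) ∈ U) :
    (𝓝[U ∩ {w : ℂ | 0 < w.im}] (x : ℂ)).NeBot := by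
  obtain ⟨r, hr, hsub⟩ := exists_ball_subset_of_ofReal_mem hU hx
  rw [← mem_closure_iff_nhdsWithin_neBot, Metric.mem_closure_iff]
  intro ε hε
  refine ⟨(x : ℂ) + ((min ε r) / 2 : ℝ) * I, ⟨hsub ?_, ?_⟩, ?_⟩
  · rw [mem_ball, dist_eq_norm, add_sub_cancel_left, norm_mul, norm_real, norm_I,
      mul_one, Real.norm_eq_abs, abs_of_pos (by positivity)]
    have := min_le_right ε r
    linarith
  · show 0 < ((x : ℂ) + ((min ε r) / 2 : ℝ) * I).im
    simp only [add_im, ofReal_im, mul_im, ofReal_re, I_im, mul_one, I_re, mul_zero, add_zero,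
      zero_add]
    positivity
  · rw [dist_eq_norm, show (x : ℂ) - ((x : ℂ) + ((min ε r) / 2 : ℝ) * I) = -((((min ε r) / 2 : ℝ) : ℂ) * I) by
      ring, norm_neg, norm_mul, norm_real, norm_I, mul_one, Real.norm_eq_abs, abs_of_pos (by positivity)]
    have := min_le_left ε r
    linarith

include hd him in
/-- **The local reflected extension at a real point** (from
`Complex.exists_differentiableOn_extension_of_im_le` on a disc `B(x, r) ⊆ U`): a holomorphic `G` on
`B(x, r/2)` agreeing with `f` on the upper half-disc, real on the diameter. [folklore] -/
theorem exists_local_extension {x r : ℝ} (hsub : ball (x : ℂ) r ⊆ U) :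
    ∃ G : ℂ → ℂ, DifferentiableOn ℂ G (ball (x : ℂ) (r / 2)) ∧
      EqOn G f (ball (x : ℂ) (r / 2) ∩ {z | 0 < z.im}) ∧
      (∀ z ∈ ball (x : ℂ) (r / 2), z.im = 0 → (G z).im = 0) ∧
      (∀ z ∈ ball (x : ℂ) (r / 2), z.im < 0 → (G z).im < 0) ∧
      ∀ a ∈ ball (x : ℂ) (r / 2), 0 ≤ a.im → ∀ b ∈ ball (x : ℂ) (r / 2), 0 ≤ b.im →
        ‖G a - G b‖ ≤ 4 * ‖a - b‖ :=
  exists_differentiableOn_extension_of_im_le (hd.mono (inter_subset_inter_left _ hsub))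
    fun z hz ↦ him z ⟨hsub hz.1, hz.2⟩

include hU in
/-- **`upperExt` is the local extension** on the closed upper half of `B(x, r/2)`: above the axis
both are `f`; at a real point the limit of `f` from `U ∩ ℍ` is the value of the continuous `G`.
[folklore] -/
theorem upperExt_eq_of_local {x r : ℝ} (hsub : ball (x : ℂ) r ⊆ U) {G : ℂ → ℂ}
    (hGd : DifferentiableOn ℂ G (ball (x : ℂ) (r / 2)))
    (hGf : EqOn G f (ball (x : ℂ) (r / 2) ∩ {z | 0 < z.im})) {z : ℂ}
    (hz : z ∈ ball (x : ℂ) (r / 2)) (hzim : 0 ≤ z.im) : upperExt U f z = G z := by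
  rcases hzim.lt_or_eq with hpos | h0
  · rw [upperExt_of_im_pos hpos, hGf ⟨hz, hpos⟩]
  · -- `z` is real: the limit of `f` from `U ∩ ℍ` is `G z`
    rw [upperExt, if_neg (by rw [← h0]; exact lt_irrefl 0)]
    have hzr : z = ((z.re : ℝ) : ℂ) := Complex.ext rfl (by simp [← h0])
    have hzU : z ∈ U := hsub (ball_subset_ball (by linarith [(le_of_lt (pos_of_mem_ball hz) : (0:ℝ) ≤ r / 2)]) hz)
    haveI : (𝓝[U ∩ {w : ℂ | 0 < w.im}] z).NeBot := by
      rw [hzr] at hzU ⊢; exact neBot_nhdsWithin_ofReal hU hzU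
    refine (Filter.Tendsto.limUnder_eq ?_)
    have hGc : ContinuousAt G z := hGd.continuousOn.continuousAt (isOpen_ball.mem_nhds hz)
    refine (hGc.tendsto.mono_left nhdsWithin_le_nhds).congr' ?_
    filter_upwards [mem_nhdsWithin_of_mem_nhds (isOpen_ball.mem_nhds hz), self_mem_nhdsWithin]
      with w hw hw'
    exact hGf ⟨hw, hw'.2⟩

include hU hd him in
/-- **The boundary values are real**: `im (upperExt U f x) = 0` for real `x ∈ U`. [folklore] -/
theorem upperExt_ofReal_im {x : ℝ} (hx : (x : ℂ) ∈ U) : (upperExt U f x).im = 0 := by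
  obtain ⟨r, hr, hsub⟩ := exists_ball_subset_of_ofReal_mem hU hx
  obtain ⟨G, hGd, hGf, hGreal, -, -⟩ := exists_local_extension hd him hsub
  have hxmem : (x : ℂ) ∈ ball (x : ℂ) (r / 2) := mem_ball_self (by positivity)
  rw [upperExt_eq_of_local hU hsub hGd hGf hxmem (by simp), hGreal _ hxmem (by simp)]

include hU hd him in
/-- **Continuity of `upperExt` on the closed upper part of `U`.** [folklore] -/
theorem continuousOn_upperExt : ContinuousOn (upperExt U f) (U ∩ {z | 0 ≤ z.im}) := by
  rintro z ⟨hzU, hzim⟩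
  have hzim' : 0 ≤ z.im := hzim
  rcases hzim'.lt_or_eq with hpos | h0
  · -- interior point of the upper half-plane: `upperExt = f` nearby
    have hfc : ContinuousAt f z :=
      (hd.continuousOn.continuousAt ((hU.inter (isOpen_lt continuous_const continuous_im)).mem_nhds
        ⟨hzU, hpos⟩))
    refine (hfc.congr ?_).continuousWithinAt
    filter_upwards [(isOpen_lt continuous_const continuous_im).mem_nhds hpos] with w hw
    exact (upperExt_of_im_pos hw).symm
  · -- real point: `upperExt = G` on the closed upper half-disc
    have hzr : z = ((z.re : ℝ) : ℂ) := Complex.ext rfl (by simp [← h0])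
    rw [hzr] at hzU ⊢
    obtain ⟨r, hr, hsub⟩ := exists_ball_subset_of_ofReal_mem hU hzU
    obtain ⟨G, hGd, hGf, -, -, -⟩ := exists_local_extension hd him hsub
    have hmem : ((z.re : ℝ) : ℂ) ∈ ball ((z.re : ℝ) : ℂ) (r / 2) := mem_ball_self (by positivity)
    have hGc : ContinuousAt G ((z.re : ℝ) : ℂ) :=
      hGd.continuousOn.continuousAt (isOpen_ball.mem_nhds hmem)
    have hev : upperExt U f =ᶠ[𝓝[U ∩ {z | 0 ≤ z.im}] ((z.re : ℝ) : ℂ)] G := by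
      filter_upwards [mem_nhdsWithin_of_mem_nhds (isOpen_ball.mem_nhds hmem), self_mem_nhdsWithin]
        with w hw hw'
      exact upperExt_eq_of_local hU hsub hGd hGf hw hw'.2
    refine ContinuousWithinAt.congr_of_eventuallyEq (hGc.continuousWithinAt) hev ?_
    exact upperExt_eq_of_local hU hsub hGd hGf hmem (by simp)

include hU hUsymm hd him in
/-- **The global reflection is holomorphic on `U`** (Schwarz reflection principle applied to
`upperExt U f`). [cite: Conway1978, Ch. IX Thm. 1.1] -/
theorem differentiableOn_schwarzExt : DifferentiableOn ℂ (schwarzExt U f) U := by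
  refine differentiableOn_schwarzReflection hU hUsymm (continuousOn_upperExt hU hd him) ?_ ?_
  · refine hd.congr fun z hz ↦ ?_
    exact upperExt_of_im_pos hz.2
  · intro z hzU hzim
    have hzr : z = ((z.re : ℝ) : ℂ) := Complex.ext rfl (by simp [hzim])
    rw [hzr] at hzU ⊢
    exact conj_eq_iff_im.2 (upperExt_ofReal_im hU hd him hzU)

include hU hd him in
/-- **`f` converges to the boundary value** `schwarzExt U f x` at a real point `x ∈ U`, from
`U ∩ ℍ`. [folklore] -/
theorem tendsto_schwarzExt_ofReal {x : ℝ} (hx : (x : ℂ) ∈ U) :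
    Tendsto f (𝓝[U ∩ {w : ℂ | 0 < w.im}] (x : ℂ)) (𝓝 (schwarzExt U f x)) := by
  obtain ⟨r, hr, hsub⟩ := exists_ball_subset_of_ofReal_mem hU hx
  obtain ⟨G, hGd, hGf, -, -, -⟩ := exists_local_extension hd him hsub
  have hmem : (x : ℂ) ∈ ball (x : ℂ) (r / 2) := mem_ball_self (by positivity)
  rw [schwarzExt_ofReal, upperExt_eq_of_local hU hsub hGd hGf hmem (by simp)]
  have hGc : ContinuousAt G x := hGd.continuousOn.continuousAt (isOpen_ball.mem_nhds hmem)
  refine (hGc.tendsto.mono_left nhdsWithin_le_nhds).congr' ?_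
  filter_upwards [mem_nhdsWithin_of_mem_nhds (isOpen_ball.mem_nhds hmem), self_mem_nhdsWithin]
    with w hw hw'
  exact hGf ⟨hw, hw'.2⟩

include hU hd him in
/-- The reflection is real on `U ∩ ℝ`. [folklore] -/
theorem schwarzExt_ofReal_im {x : ℝ} (hx : (x : ℂ) ∈ U) : (schwarzExt U f x).im = 0 := by
  rw [schwarzExt_ofReal]; exact upperExt_ofReal_im hU hd him hx

omit hU in
include him in
/-- The reflection has positive imaginary part on `U ∩ ℍ` and negative below. [folklore] -/
theorem schwarzExt_im_pos {z : ℂ} (hz : z ∈ U) (hzim : 0 < z.im) : 0 < (schwarzExt U f z).im := by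
  rw [schwarzExt_of_im_pos hzim]; exact (him z ⟨hz, hzim⟩).1

include hUsymm him in
/-- Below the axis the reflection has negative imaginary part. [folklore] -/
theorem schwarzExt_im_neg {z : ℂ} (hz : z ∈ U) (hzim : z.im < 0) : (schwarzExt U f z).im < 0 := by
  rw [schwarzExt_of_im_neg hzim, conj_im, neg_lt_zero]
  exact (him _ ⟨hUsymm z hz, by show 0 < (conj z).im; rw [conj_im]; linarith⟩).1

include hU hd him in
/-- **The reflection commutes with conjugation** on `U`. [folklore] -/
theorem schwarzExt_conj {z : ℂ} (hz : z ∈ U) : schwarzExt U f (conj z) = conj (schwarzExt U f z) := by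
  rcases lt_trichotomy z.im 0 with hneg | h0 | hpos
  · rw [schwarzExt_of_im_neg hneg, conj_conj, schwarzExt_of_im_pos]
    rw [conj_im]; linarith
  · have hzr : z = ((z.re : ℝ) : ℂ) := Complex.ext rfl (by simp [h0])
    rw [hzr, conj_ofReal]
    rw [hzr] at hz
    exact (conj_eq_iff_im.2 (schwarzExt_ofReal_im hU hd him hz)).symm
  · rw [schwarzExt_of_im_neg (by rw [conj_im]; linarith), conj_conj, schwarzExt_of_im_pos hpos]

include him in
/-- On `U ∩ ℍ`, `im (schwarzExt U f z) ≤ im z` (the hypothesis `im f ≤ im`, restated for the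
extension). [folklore] -/
theorem schwarzExt_im_le {z : ℂ} (hz : z ∈ U) (hzim : 0 < z.im) : (schwarzExt U f z).im ≤ z.im := by
  rw [schwarzExt_of_im_pos hzim]; exact (him z ⟨hz, hzim⟩).2

/-! ### The uniform derivative bound near real points -/

include hU hUsymm hd him in
/-- **`‖(schwarzExt U f)'‖ ≤ 2` on `B(x, r/2)` whenever `B(x, r) ⊆ U`** (`x ∈ ℝ`): on the open
upper half-disc this is Schwarz–Pick (`Complex.norm_deriv_le_two_of_im_le`), below by symmetry,
and on the diameter by continuity of the derivative. [folklore] -/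
theorem norm_deriv_schwarzExt_le_two {x r : ℝ} (hsub : ball (x : ℂ) r ⊆ U) {z : ℂ}
    (hz : z ∈ ball (x : ℂ) (r / 2)) : ‖deriv (schwarzExt U f) z‖ ≤ 2 := by
  have hF := differentiableOn_schwarzExt hU hUsymm hd him
  -- the bound off the axis
  have hupper : ∀ w ∈ ball (x : ℂ) (r / 2), 0 < w.im → ‖deriv (schwarzExt U f) w‖ ≤ 2 := by
    intro w hw hwim
    rw [(schwarzExt_eventuallyEq_of_im_pos (U := U) (f := f) hwim).deriv_eq]
    exact norm_deriv_le_two_of_im_le (hd.mono (inter_subset_inter_left _ hsub))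
      (fun z hz ↦ him z ⟨hsub hz.1, hz.2⟩) hw hwim
  have hlower : ∀ w ∈ ball (x : ℂ) (r / 2), w.im < 0 → ‖deriv (schwarzExt U f) w‖ ≤ 2 := by
    intro w hw hwim
    rw [(schwarzExt_eventuallyEq_of_im_neg (U := U) (f := f) hwim).deriv_eq, deriv_conj_conj]
    simp only [Function.comp_apply, norm_conj]
    have hcw : conj w ∈ ball (x : ℂ) (r / 2) := by
      rw [mem_ball, ← conj_ofReal, dist_conj_conj]; exact hw
    rw [← (schwarzExt_eventuallyEq_of_im_pos (U := U) (f := f) (by rw [conj_im]; linarith)).deriv_eq]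
    exact hupper _ hcw (by rw [conj_im]; linarith)
  rcases lt_trichotomy z.im 0 with hneg | h0 | hpos
  · exact hlower z hz hneg
  · -- on the diameter: continuity of the derivative and the bound from above the axis
    have hzU : z ∈ U := hsub (ball_subset_ball (by linarith [pos_of_mem_ball hz]) hz)
    have hdc : ContinuousAt (deriv (schwarzExt U f)) z :=
      ((hF.analyticOnNhd hU).deriv z hzU).continuousAt
    have hT : Tendsto (fun y : ℝ ↦ ‖deriv (schwarzExt U f) (z + y * I)‖) (𝓝[>] 0)
        (𝓝 ‖deriv (schwarzExt U f) z‖) := by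
      have h1 : Tendsto (fun y : ℝ ↦ z + y * I) (𝓝 0) (𝓝 z) := by
        have : Continuous fun y : ℝ ↦ z + y * I := by fun_prop
        simpa using this.tendsto 0
      exact ((continuous_norm.continuousAt.comp hdc).tendsto.comp h1).mono_left nhdsWithin_le_nhds
    refine le_of_tendsto hT ?_
    have hev := eventually_add_mul_I_mem hz h0.ge
    filter_upwards [hev] with y hy
    exact hupper _ hy.1 hy.2
  · exact hupper z hz hpos

include hU hUsymm hd him in
/-- Consequently `schwarzExt U f` is `2`-Lipschitz on `B(x, r/2)` when `B(x, r) ⊆ U`, `x ∈ ℝ`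
(convexity and the mean value inequality). [folklore] -/
theorem lipschitzOnWith_schwarzExt {x r : ℝ} (hsub : ball (x : ℂ) r ⊆ U) :
    LipschitzOnWith 2 (schwarzExt U f) (ball (x : ℂ) (r / 2)) := by
  have hF := differentiableOn_schwarzExt hU hUsymm hd him
  have hsub' : ball (x : ℂ) (r / 2) ⊆ U := fun z hz ↦
    hsub (ball_subset_ball (by linarith [pos_of_mem_ball hz]) hz)
  refine (convex_ball _ _).lipschitzOnWith_of_nnnorm_deriv_le (𝕜 := ℂ)
    (fun z hz ↦ hF.differentiableAt (hU.mem_nhds (hsub' hz))) fun z hz ↦ ?_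
  have := norm_deriv_schwarzExt_le_two hU hUsymm hd him hsub hz
  rw [← NNReal.coe_le_coe, coe_nnnorm]
  exact_mod_cast this

end Main

end Literature.Analysis.Complex
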